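import Literature.AlgebraicGeometry.Frobenioids.ElementaryFrobenioid
import Literature.AlgebraicGeometry.Frobenioids.ModelFrobenioid
import Literature.AlgebraicGeometry.Frobenioids.PreFrobenioidData
import HarnessLib

/-!
# Frobenioids I, Theorem 5.2 (i): the operations `(Base, Div, deg_Fr)` of a model Frobenioid

Mochizuki, *The geometry of Frobenioids I* (2008), Thm. 5.2 (i) p. 100: "the Frobenius degree,
projection to `D`, and zero divisor determine a functor `C → F_Φ`" [cite: MochizukiFrdI2008, Thm. 5.2 (i) p.100].
For the model Frobenioid `ModelFrobenioid Φ B DivB` of `ModelFrobenioid.lean` (seat abc-iut-L1-t2) this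
functor, in operations form, is the `PreFrobenioidData` below — so that the §3/§4/§6 statement files
(which are typed over `PreFrobenioidData`, e.g. `ArithModelFrobenioid.ops` in Thm. 6.4, the
`GeometricModelFrobenioid.ops` in Thm. 6.2) apply to the model Frobenioids of Examples 6.1 and 6.3
(`C_{V,K̃,D_K}`, `C_{F̃/F}` are model Frobenioids, Thm. 5.2 (ii)). The four laws are t2's
`div_id/div_comp/degFr_id/degFr_comp` (Remark 1.1.1 for the model category) and found's
`pull Φ f = (Φ.map f.op).hom`. No statement of the paper is strengthened.
-/

noncomputable section

namespace Literature.AlgebraicGeometry.Frobenioids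

open CategoryTheory Opposite

universe w v u

variable {D : Type u} [Category.{v} D] (Φ B : Dᵒᵖ ⥤ CommMonCat.{w}) (DivB : B ⟶ monoidGp Φ)

namespace PreFrobenioidData

/-- **Theorem 5.2 (i)**, last sentence, in operations form: the model Frobenioid's
`(Base, Div, deg_Fr)` as a `PreFrobenioidData` over `D` with divisor monoid `Φ`.
[cite: MochizukiFrdI2008, Thm. 5.2 (i) p.100] -/
def ofModel : PreFrobenioidData.{w} (ModelFrobenioid Φ B DivB) D where
  base := ModelFrobenioid.baseFunctor Φ B DivB
  Mon X := Φ.obj (op X)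
  pull f := Frobenioids.pull Φ f
  pull_id X x := Frobenioids.pull_id Φ X x
  pull_comp β α x := Frobenioids.pull_comp Φ β α x
  div φ := ModelFrobenioid.div φ
  degFr φ := ModelFrobenioid.degFr φ
  div_id _ := ModelFrobenioid.div_id
  div_comp ψ φ := ModelFrobenioid.div_comp ψ φ
  degFr_id _ := ModelFrobenioid.degFr_id
  degFr_comp ψ φ := (ModelFrobenioid.degFr_comp ψ φ).trans (mul_comm _ _)

variable {Φ B DivB}

/-- `Base` of a model Frobenioid is the projection `(A_D, α) ↦ A_D`. [cite: MochizukiFrdI2008, Thm. 5.2 (i) p.100] -/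
@[simp] theorem ofModel_base_obj (X : ModelFrobenioid Φ B DivB) : (ofModel Φ B DivB).base.obj X = X.base := rfl

/-- `deg_Fr` of a model Frobenioid arrow. [cite: MochizukiFrdI2008, Thm. 5.2 (i) p.100] -/
@[simp] theorem ofModel_degFr {X Y : ModelFrobenioid Φ B DivB} (φ : X ⟶ Y) :
    (ofModel Φ B DivB).degFr φ = ModelFrobenioid.degFr φ := rfl

/-- `Div` of a model Frobenioid arrow. [cite: MochizukiFrdI2008, Thm. 5.2 (i) p.100] -/
@[simp] theorem ofModel_div {X Y : ModelFrobenioid Φ B DivB} (φ : X ⟶ Y) :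
    (ofModel Φ B DivB).div φ = ModelFrobenioid.div φ := rfl

/-- In a model Frobenioid an arrow is linear iff `deg_Fr(φ) = 1` (unfolding). [cite: MochizukiFrdI2008, Thm. 5.2 (i) p.100] -/
theorem ofModel_isLinear_iff {X Y : ModelFrobenioid Φ B DivB} (φ : X ⟶ Y) :
    (ofModel Φ B DivB).IsLinear φ ↔ ModelFrobenioid.degFr φ = 1 := Iff.rfl

end PreFrobenioidData

end Literature.AlgebraicGeometry.Frobenioids

end
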